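import Literature.MathematicalPhysics.QuantumManyBody.BosonicFloor
import Literature.MathematicalPhysics.QuantumManyBody.PeriodicBoseGasImpurityTranslation
import Literature.MathematicalPhysics.QuantumManyBody.PeriodicBoseGasCouplingPath
import Mathlib.MeasureTheory.Measure.Prod
import HarnessLib

/-!
# Crux `CorrectorClosure` (stmt-AtomisticToContinuum-12058), line `healing-scale-kac-insertion` —
registered sub-goal `periodicGroundStateEnergy_succ_le_add_born` (chemical potential ≤ Born term)

Supports (does not close) stmt-AtomisticToContinuum-12058, route `BECInsertionCorrector`.
A registered sub-goal of the heart `stub_kacClosure` of the lead's skeleton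
`Cruxes/CorrectorClosure/Lines/healing-scale-kac-insertion.lean`, in the torus vocabulary of
`Literature/MathematicalPhysics/QuantumManyBody/PeriodicBoseGas*.lean` (cell `[0,L)³ = cell L`,
periodised pair potential `v^per = periodizedPotential v L`, periodic trial states, energies
`periodicEnergy`, ground-state energies `periodicGroundStateEnergy v N L = E^per(N, L)`, the
pinned-scatterer energy `impurityPeriodicEnergy`, and the insertion state
`insertionState hL Φ = φ₀ ⊗ Φ` of `PeriodicBoseGasCouplingPath.lean`, the tagged product state with
the normalised constant one-body mode `φ₀ ≡ L^{-3/2}`).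

**Statement.** For a measurable pair potential `v ≥ 0` (hard cores allowed), `N` bosons and a
torus of side `L > 0`, the chemical potential `μ = E^per(N+1, L) - E^per(N, L)` is at most the
uniform Born term `N L⁻³ ∫_{[0,L)³} v^per = ρ ∫_{ℝ³} v`:
`E^per(N+1, L) ≤ E^per(N, L) + N · (L³)⁻¹ · ∫_{[0,L)³} v^per(x) dx`.
In the line this is the (variational) non-negativity `m* = ⟨W⟩ - μ ≥ 0` of the infrared mass of the
Kipnis–Varadhan expansion.

**Proof.** Fix an `N`-boson trial state `Φ` and insert one particle in the normalised constant
mode `φ₀ ≡ L^{-3/2}`: the tagged state `φ₀ ⊗ Φ : (x₀, Y) ↦ L^{-3/2} Φ(Y)` (particle `0`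
distinguishable, `insertionState`). By the bosonic floor
(`periodicGroundStateEnergy_succ_le_taggedPeriodicEnergy_one`, `BosonicFloor.lean`: the bosonic
ground-state energy is the absolute one, no Perron–Frobenius)
`E^per(N+1, L) ≤ ⟨φ₀ ⊗ Φ, H(N+1, L) φ₀ ⊗ Φ⟩`, and by the product formula
(`taggedPeriodicEnergy_product`) this energy is `∫ |∇φ₀|² = 0` plus the `|φ₀|²`-average over the
pinning point `x₀` of the pinned-scatterer energy
`⟨Φ, (H(N, L) + ∑ⱼ v^per(xⱼ - x₀)) Φ⟩`. Averaging the scatterer over the cell costs exactly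
`N ∫_{[0,L)³} v^per` whatever `Φ` is (Tonelli, the translation invariance
`∫_{[0,L)³} v^per(xⱼ - x₀) dx₀ = ∫_{[0,L)³} v^per` of `lintegral_cell_periodizedPotential_sub`, and
`∫ |Φ|² = 1`), so `E^per(N+1, L) ≤ ⟨Φ, H(N, L) Φ⟩ + N L⁻³ ∫_{[0,L)³} v^per` for every `Φ`; take
the infimum over `Φ` (`ENNReal.iInf_add`).
-/

noncomputable section

open MeasureTheory
open scoped ENNReal NNReal BigOperators

namespace Summit.AtomisticToContinuum.BoseEinsteinCondensation.Theorems.CorrectorClosure.HealingScaleKacInsertion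

open Literature.MathematicalPhysics.QuantumManyBody.BoseGas

variable {N : ℕ} {L : ℝ}

/-! ### Measurability of the pinned-scatterer potential -/

/-- The periodised potential of a measurable profile is measurable. [folklore] -/
private theorem measurable_periodizedPotential_cpb {v : ℝ → ℝ≥0∞} (hv : Measurable v) (L : ℝ) :
    Measurable (periodizedPotential v L) := by
  show Measurable fun x => ∑' n : Fin 3 → ℤ, v ‖x - latticeVec L n‖
  exact Measurable.tsum fun n => hv.comp (measurable_id.sub_const _).norm

/-- The pinned-scatterer potential `(x, X) ↦ ∑ⱼ v^per(xⱼ - x)` is jointly measurable in the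
scatterer position and the configuration of the bosons. [folklore] -/
theorem measurable_impurityInteraction_uncurry {v : ℝ → ℝ≥0∞} (hv : Measurable v) (L : ℝ) :
    Measurable fun p : Space × Config N => impurityInteraction v L p.1 p.2 := by
  unfold impurityInteraction
  refine Finset.measurable_sum _ fun j _ => ?_
  exact (measurable_periodizedPotential_cpb hv L).comp
    (((measurable_pi_apply j).comp measurable_snd).sub measurable_fst)

/-- The pinned-scatterer potential is measurable in the scatterer position. [folklore] -/
theorem measurable_impurityInteraction_left {v : ℝ → ℝ≥0∞} (hv : Measurable v) (L : ℝ)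
    (X : Config N) : Measurable fun x : Space => impurityInteraction v L x X := by
  unfold impurityInteraction
  refine Finset.measurable_sum _ fun j _ => ?_
  exact (measurable_periodizedPotential_cpb hv L).comp (measurable_id.const_sub (X j))

/-! ### Averaging the scatterer over the cell -/

/-- **Cell average of one periodised pair potential**: `∫_{[0,L)³} v^per(y - x) dx =
∫_{[0,L)³} v^per(x) dx` for every `y ∈ ℝ³` (both sides equal `∫_{ℝ³} v(|·|)` by unfolding the
periodisation, `lintegral_cell_periodizedPotential_sub`). [folklore] -/
theorem lintegral_cell_periodizedPotential_sub_left (hL : 0 < L) {v : ℝ → ℝ≥0∞}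
    (hv : Measurable v) (y : Space) :
    ∫⁻ x in cell L, periodizedPotential v L (y - x) =
      ∫⁻ x in cell L, periodizedPotential v L x := by
  calc ∫⁻ x in cell L, periodizedPotential v L (y - x)
      = ∫⁻ x in cell L, periodizedPotential v L (x - y) :=
        lintegral_congr fun x => periodizedPotential_sub_comm v L y x
    _ = ∫⁻ x : Space, v ‖x‖ := lintegral_cell_periodizedPotential_sub hL hv y
    _ = ∫⁻ x in cell L, periodizedPotential v L (x - 0) :=
        (lintegral_cell_periodizedPotential_sub hL hv 0).symm
    _ = ∫⁻ x in cell L, periodizedPotential v L x := by simp only [sub_zero]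

/-- **Cell average of the pinned-scatterer potential**: `∫_{[0,L)³} ∑ⱼ v^per(xⱼ - x) dx =
N · ∫_{[0,L)³} v^per` for every configuration `X` of the `N` bosons. [folklore] -/
theorem lintegral_cell_impurityInteraction (hL : 0 < L) {v : ℝ → ℝ≥0∞} (hv : Measurable v)
    (X : Config N) :
    ∫⁻ x in cell L, impurityInteraction v L x X =
      (N : ℝ≥0∞) * ∫⁻ x in cell L, periodizedPotential v L x := by
  have hmeas : ∀ j : Fin N, Measurable fun x : Space => periodizedPotential v L (X j - x) :=
    fun j => (measurable_periodizedPotential_cpb hv L).comp (measurable_id.const_sub (X j))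
  unfold impurityInteraction
  rw [lintegral_finsetSum _ fun j _ => hmeas j]
  simp only [lintegral_cell_periodizedPotential_sub_left hL hv]
  rw [Finset.sum_const, Finset.card_univ, Fintype.card_fin, nsmul_eq_mul]

/-- **The scatterer term averaged over the pinning point**: for a periodic `N`-boson state `Φ`,
`∫_{[0,L)³} (∫_{[0,L)^{3N}} ∑ⱼ v^per(xⱼ - x) |Φ(X)|² dX) dx = N · ∫_{[0,L)³} v^per`
(Tonelli, the cell average of each `v^per(xⱼ - ·)`, and `∫ |Φ|² = 1`). [folklore] -/
theorem lintegral_cell_lintegral_impurityInteraction_mul (hL : 0 < L) {v : ℝ → ℝ≥0∞}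
    (hv : Measurable v) (Φ : PeriodicTrialState N L) :
    ∫⁻ x in cell L, ∫⁻ X in cellN N L, impurityInteraction v L x X * (‖Φ.ψ X‖₊ : ℝ≥0∞) ^ 2 =
      (N : ℝ≥0∞) * ∫⁻ x in cell L, periodizedPotential v L x := by
  have hm : AEMeasurable (Function.uncurry fun (x : Space) (X : Config N) =>
      impurityInteraction v L x X * (‖Φ.ψ X‖₊ : ℝ≥0∞) ^ 2)
      ((volume.restrict (cell L)).prod (volume.restrict (cellN N L))) :=
    ((measurable_impurityInteraction_uncurry hv L).mul
      (Φ.measurable_normSq.comp measurable_snd)).aemeasurable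
  rw [lintegral_lintegral_swap hm]
  calc ∫⁻ X in cellN N L, ∫⁻ x in cell L, impurityInteraction v L x X * (‖Φ.ψ X‖₊ : ℝ≥0∞) ^ 2
      = ∫⁻ X in cellN N L, ((N : ℝ≥0∞) * ∫⁻ x in cell L, periodizedPotential v L x) *
          (‖Φ.ψ X‖₊ : ℝ≥0∞) ^ 2 := by
        refine lintegral_congr fun X => ?_
        rw [lintegral_mul_const _ (measurable_impurityInteraction_left hv L X),
          lintegral_cell_impurityInteraction hL hv X]
    _ = (N : ℝ≥0∞) * ∫⁻ x in cell L, periodizedPotential v L x := by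
        rw [lintegral_const_mul _ Φ.measurable_normSq, Φ.norm_eq, mul_one]

/-- **Cell average of the pinned-scatterer energy**: for a periodic `N`-boson state `Φ` on the
torus of side `L > 0`,
`∫_{[0,L)³} ⟨Φ, (H(N,L) + ∑ⱼ v^per(xⱼ - x)) Φ⟩ dx = L³ ⟨Φ, H(N,L) Φ⟩ + N ∫_{[0,L)³} v^per`.
[folklore] -/
theorem lintegral_cell_impurityPeriodicEnergy (hL : 0 < L) {v : ℝ → ℝ≥0∞} (hv : Measurable v)
    (Φ : PeriodicTrialState N L) :
    ∫⁻ x in cell L, impurityPeriodicEnergy v x Φ =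
      ENNReal.ofReal L ^ 3 * periodicEnergy v Φ +
        (N : ℝ≥0∞) * ∫⁻ x in cell L, periodizedPotential v L x := by
  simp only [impurityPeriodicEnergy_eq]
  rw [lintegral_add_left measurable_const, setLIntegral_const, volume_cell,
    mul_comm (periodicEnergy v Φ), lintegral_cell_lintegral_impurityInteraction_mul hL hv Φ]

/-! ### Inserting one particle in the constant mode -/

/-- **Energy of the constant-mode insertion.** For a periodic `N`-boson state `Φ` on the torus of
side `L > 0`, the insertion state `φ₀ ⊗ Φ : (x₀, Y) ↦ L^{-3/2} Φ(Y)` (one particle added in the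
normalised constant mode, particle `0` tagged) has, at equal masses,
`⟨φ₀ ⊗ Φ, H(N+1, L) φ₀ ⊗ Φ⟩ = ⟨Φ, H(N, L) Φ⟩ + N (L³)⁻¹ ∫_{[0,L)³} v^per`: the new particle has no
kinetic energy and feels the bath only through the cell average of the pinned-scatterer potential
(the uniform Born term). [folklore] -/
theorem taggedPeriodicEnergy_one_insertionState (hL : 0 < L) {v : ℝ → ℝ≥0∞} (hv : Measurable v)
    (Φ : PeriodicTrialState N L) :
    taggedPeriodicEnergy v 1 (insertionState hL Φ) =
      periodicEnergy v Φ +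
        (N : ℝ≥0∞) * (ENNReal.ofReal (L ^ 3))⁻¹ * ∫⁻ x in cell L, periodizedPotential v L x := by
  have h3 : ENNReal.ofReal L ^ 3 ≠ 0 := pow_ne_zero _ (ENNReal.ofReal_pos.2 hL).ne'
  have h3' : ENNReal.ofReal L ^ 3 ≠ ⊤ := ENNReal.pow_ne_top ENNReal.ofReal_ne_top
  -- no kinetic energy in the constant mode
  have hkin : ∫⁻ x in cell L, gradSqC (fun _ : Space => ((Real.sqrt (L ^ 3))⁻¹ : ℂ)) x = 0 := by
    refine (lintegral_congr fun x => ?_).trans lintegral_zero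
    simp [gradSqC]
  rw [insertionState, taggedPeriodicEnergy_product hv, hkin, mul_zero, zero_add,
    lintegral_const_mul' _ _ (ENNReal.pow_ne_top ENNReal.coe_ne_top), nnnorm_constantMode_sq hL,
    lintegral_cell_impurityPeriodicEnergy hL hv Φ, mul_add, ← mul_assoc,
    ENNReal.inv_mul_cancel h3 h3', one_mul, ← mul_assoc,
    mul_comm ((ENNReal.ofReal L ^ 3)⁻¹) (N : ℝ≥0∞), ← ENNReal.ofReal_pow hL.le]

/-! ### The registered sub-goal -/

/-- **Registered sub-goal of line `healing-scale-kac-insertion` — the chemical potential is at most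
the uniform Born term.** For a measurable pair potential `v ≥ 0` (hard cores allowed), `N` bosons
and a torus of side `L > 0`,
`E^per(N+1, L) ≤ E^per(N, L) + N · (L³)⁻¹ · ∫_{[0,L)³} v^per`: adding one particle in the constant
mode to any `N`-boson trial state `Φ` costs exactly the cell average `N L⁻³ ∫_{[0,L)³} v^per` of the
pinned-scatterer potential on top of `⟨Φ, H(N, L) Φ⟩` (`taggedPeriodicEnergy_one_insertionState`),
the bosonic ground-state energy is below the energy of this tagged state
(`periodicGroundStateEnergy_succ_le_taggedPeriodicEnergy_one`), and one takes the infimum over `Φ`.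
[folklore] -/
theorem periodicGroundStateEnergy_succ_le_add_born (v : ℝ → ℝ≥0∞) (hv : Measurable v) (N : ℕ)
    (L : ℝ) (hL : 0 < L) :
    periodicGroundStateEnergy v (N + 1) L ≤
      periodicGroundStateEnergy v N L +
        (N : ℝ≥0∞) * (ENNReal.ofReal (L ^ 3))⁻¹ * ∫⁻ x in cell L, periodizedPotential v L x :=
  calc periodicGroundStateEnergy v (N + 1) L
      ≤ ⨅ Φ : PeriodicTrialState N L, (periodicEnergy v Φ +
          (N : ℝ≥0∞) * (ENNReal.ofReal (L ^ 3))⁻¹ * ∫⁻ x in cell L, periodizedPotential v L x) :=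
        le_iInf fun Φ =>
          (periodicGroundStateEnergy_succ_le_taggedPeriodicEnergy_one hv
              (insertionState hL Φ)).trans_eq
            (taggedPeriodicEnergy_one_insertionState hL hv Φ)
    _ = periodicGroundStateEnergy v N L +
          (N : ℝ≥0∞) * (ENNReal.ofReal (L ^ 3))⁻¹ * ∫⁻ x in cell L, periodizedPotential v L x := by
        rw [periodicGroundStateEnergy, ENNReal.iInf_add]

end Summit.AtomisticToContinuum.BoseEinsteinCondensation.Theorems.CorrectorClosure.HealingScaleKacInsertion

end
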